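import Mathlib.Analysis.SpecialFunctions.Complex.Circle
import Mathlib.Analysis.SpecialFunctions.Trigonometric.Basic
import HarnessLib

/-!
# Reference framings on the two tori of `Σ̄₂` and the four quadrant estimates

Topic `Literature/Topology/FourManifolds` (fact seat of the Seiberg–Witten leaf
`Literature.Barriers.SmoothPoincare4.akhmedovPark2010_lemma8_invariants`; block 2 of
Akhmedov–Park's `X₁(m)`, A. Akhmedov, B. D. Park, Invent. Math. 181 (2010), §3: the genus-2
surface `Σ̄₂ ⊂ T⁴ # ℂℙ²bar` obtained from the tori `S₁ = T² × {y₀}` and `S₂ = T_β` by resolving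
the double point over `x₂` and blowing up the one over `x₃`, WITH ITS TUBULAR NEIGHBOURHOOD).
Assembling the tube of `Σ̄₂` from the product tubes of `S₁`, `S₂` and the two local models
(`DoublePointResolutionNeck.lean`, `BlowUpLineCapTube.lean`) requires on each torus a smooth unit
"framing function" on the complement of the two plumbing points with PRESCRIBED germs there
(the conjugate unit coordinate `conj â` at a resolved point, the unit coordinate `â` at a blown-up
point; total winding zero).  `FramingPhaseCorrection.lean` reduces this to a REFERENCE unit
function within `90°` of the prescribed germ near each point.  This file supplies the references
and the four `90°` estimates, as elementary facts about points of the unit circle: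

* on the braid-axis torus `T′ ∋ (σ, τ)` (plumbing points `(1, 1)`, `(-1, 1)`): the reference
  `g = (τ - 1) - Im σ` vanishes exactly at `(±1, 1)` (`refFramingAxis_eq_zero_iff`), and with the
  plumbing coordinate direction `b₀ = Im σ²/Re σ² + i Im τ/Re τ` one has `Re (b₀ g) < 0` near
  `(1, 1)` (`re_axisCoord_mul_refFraming_neg`) and `Re (b₀ conj g) > 0` near `(-1, 1)`
  (`re_axisCoord_mul_conj_refFraming_pos`), off the points themselves;
* on the first torus `T ∋ (z₁, z₂)` (plumbing points `x₂ = (1, 1)`, `x₃ = (ϑ⁻², 1)`,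
  `ϑ = e^{i r₀}`): the reference `g₁ = (z₂ - 1) + (Re (z₁ ϑ) - Re ϑ)` vanishes exactly at `x₂`, `x₃`
  (`refFramingFirst_eq_zero_iff`), and with the quarter-chart direction
  `a₀ = Im z₁²/Re z₁² + i Im z₂²/Re z₂²` (resp. the same in `ζ = z₁ ϑ²` at `x₃`) one has
  `Re (a₀ g₁) < 0` near `x₂` (`re_quarterCoord_mul_refFraming_neg`) and `Re (a₀ conj g₁) > 0` near
  `x₃` (`re_quarterCoord_mul_conj_refFraming_pos`).

The estimates are polynomial inequalities in the real and imaginary parts after clearing the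
positive denominators (`core_*`).  Everything is proved; no definitions.

## References

* A. Akhmedov, B. D. Park, Invent. Math. 181 (2010) 577–603 = arXiv:math/0701829, §3. [AkhmedovPark2010]
-/

noncomputable section

open scoped Real ComplexConjugate
open Complex

namespace Literature.Topology.FourManifolds

namespace BraidFraming

/-! ### §0 Unit-circle bookkeeping -/

/-- `Re² + Im² = 1` on the circle. [folklore] -/
theorem re_sq_add_im_sq (z : Circle) : (z : ℂ).re ^ 2 + (z : ℂ).im ^ 2 = 1 := by
  have h1 : ‖(z : ℂ)‖ ^ 2 = 1 := by rw [Circle.norm_coe, one_pow]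
  rw [Complex.sq_norm, Complex.normSq_apply] at h1
  nlinarith [h1]

/-- `Re z² = Re² - Im²`. [folklore] -/
theorem sq_re (z : ℂ) : (z ^ 2).re = z.re ^ 2 - z.im ^ 2 := by
  rw [sq, Complex.mul_re]; ring

/-- `Im z² = 2 Re Im`. [folklore] -/
theorem sq_im (z : ℂ) : (z ^ 2).im = 2 * z.re * z.im := by
  rw [sq, Complex.mul_im]; ring

/-- A point of the circle with `Im = 0` and `Re > 0` is `1`. [folklore] -/
theorem eq_one_of_im_eq_zero {z : Circle} (h0 : (z : ℂ).im = 0) (hpos : 0 < (z : ℂ).re) :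
    z = 1 := by
  have h := re_sq_add_im_sq z
  rw [h0] at h
  have hre : (z : ℂ).re = 1 := by nlinarith
  apply Subtype.ext
  apply Complex.ext <;> simp [hre, h0]

/-- A point of the circle with `Im = 0` and `Re < 0` is `-1` (as a complex number). [folklore] -/
theorem coe_eq_neg_one_of_im_eq_zero {z : Circle} (h0 : (z : ℂ).im = 0) (hneg : (z : ℂ).re < 0) :
    (z : ℂ) = -1 := by
  have h := re_sq_add_im_sq z
  rw [h0] at h
  have hre : (z : ℂ).re = -1 := by nlinarith
  apply Complex.ext <;> simp [hre, h0]

/-- Two points of the circle with the same real part are equal or inverse to each other. [folklore] -/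
theorem eq_or_eq_inv_of_re_eq {w v : Circle} (h : (w : ℂ).re = (v : ℂ).re) : w = v ∨ w = v⁻¹ := by
  have hw := re_sq_add_im_sq w
  have hv := re_sq_add_im_sq v
  have him : (w : ℂ).im = (v : ℂ).im ∨ (w : ℂ).im = -(v : ℂ).im := by
    have : (w : ℂ).im ^ 2 = (v : ℂ).im ^ 2 := by rw [h] at hw; linarith
    exact sq_eq_sq_iff_eq_or_eq_neg.1 this
  rcases him with him | him
  · left
    exact Subtype.ext (Complex.ext h him)
  · right
    apply Subtype.ext
    rw [Circle.coe_inv_eq_conj]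
    exact Complex.ext (by simpa using h) (by simpa using him)

/-- Real part of a product written in real coordinates. [folklore] -/
theorem re_mk_mul_mk (A B u v : ℝ) :
    (((A : ℂ) + (B : ℂ) * I) * ((u : ℂ) + (v : ℂ) * I)).re = A * u - B * v := by
  simp [Complex.mul_re]

/-! ### §1 The braid-axis torus `T′`: reference `g = (τ - 1) - Im σ` -/

/-- **The axis reference framing vanishes exactly at `(1, 1)` and `(-1, 1)`.** [folklore] -/
theorem refFramingAxis_eq_zero_iff {σ τ : Circle} :
    ((τ : ℂ) - 1) - (((σ : ℂ).im : ℝ) : ℂ) = 0 ↔ τ = 1 ∧ ((σ : ℂ) = 1 ∨ (σ : ℂ) = -1) := by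
  constructor
  · intro h
    have him : (τ : ℂ).im = 0 := by simpa using congrArg Complex.im h
    have hre : (τ : ℂ).re - 1 - (σ : ℂ).im = 0 := by simpa using congrArg Complex.re h
    have hτ := re_sq_add_im_sq τ
    have hσ := re_sq_add_im_sq σ
    rw [him] at hτ
    have hτre : (τ : ℂ).re = 1 := by
      have hsq : ((τ : ℂ).re - 1) * ((τ : ℂ).re + 1) = 0 := by nlinarith
      rcases mul_eq_zero.1 hsq with h1 | h1
      · linarith
      · exfalso
        have hi : (σ : ℂ).im = -2 := by linarith
        rw [hi] at hσ
        nlinarith [sq_nonneg ((σ : ℂ).re)]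
    have hτ1 : τ = 1 := eq_one_of_im_eq_zero him (by rw [hτre]; exact one_pos)
    have hσim : (σ : ℂ).im = 0 := by linarith
    refine ⟨hτ1, ?_⟩
    rcases lt_trichotomy ((σ : ℂ).re) 0 with hneg | hzero | hpos
    · exact Or.inr (coe_eq_neg_one_of_im_eq_zero hσim hneg)
    · rw [hzero, hσim] at hσ; norm_num at hσ
    · exact Or.inl (by rw [eq_one_of_im_eq_zero hσim hpos]; rfl)
  · rintro ⟨rfl, h | h⟩
    · simp [h]
    · simp [h]

/-- Polynomial core of the estimate at `(1, 1)`. [folklore] -/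
theorem core_axis_neg {x y p q : ℝ} (hx : 19 / 20 ≤ x) (hxy : x ^ 2 + y ^ 2 = 1) (hp : 1 / 2 ≤ p)
    (hpq : p ^ 2 + q ^ 2 = 1) (hne : y ≠ 0 ∨ q ≠ 0) :
    2 * x * y * p * (p - 1 - y) - q ^ 2 * (x ^ 2 - y ^ 2) < 0 := by
  have hx1 : x ≤ 1 := by nlinarith
  have hp1 : p ≤ 1 := by nlinarith
  have hy2 : y ^ 2 ≤ 1 / 10 := by nlinarith
  have hyabs : |y| ≤ 1 / 3 := abs_le.2 ⟨by nlinarith, by nlinarith⟩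
  have h1p : 0 ≤ 1 - p := by linarith
  have h1p' : 1 - p ≤ q ^ 2 := by nlinarith
  have hxp : 0 ≤ x * p := by positivity
  have hxp1 : x * p ≤ 1 := by nlinarith
  have s1 : y * (p - 1) ≤ |y| * (1 - p) := by
    have := mul_le_mul_of_nonneg_right (neg_le_abs y) h1p
    linarith
  have s2 : x * p * (y * (p - 1)) ≤ x * p * (|y| * (1 - p)) := mul_le_mul_of_nonneg_left s1 hxp
  have s3 : x * p * (|y| * (1 - p)) ≤ 1 * (|y| * q ^ 2) :=
    mul_le_mul hxp1 (mul_le_mul_of_nonneg_left h1p' (abs_nonneg y)) (by positivity) zero_le_one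
  have hpos : 0 < y ^ 2 + q ^ 2 := by
    rcases hne with h | h <;> positivity
  have hid : 2 * x * y * p * (p - 1 - y) = 2 * (x * p * (y * (p - 1))) - 2 * (x * p) * y ^ 2 := by
    ring
  rw [hid]
  nlinarith [sq_abs y, abs_nonneg y]

/-- Polynomial core of the estimate at `(-1, 1)`. [folklore] -/
theorem core_axis_pos {x y p q : ℝ} (hx : x ≤ -(19 / 20)) (hxy : x ^ 2 + y ^ 2 = 1) (hp : 1 / 2 ≤ p)
    (hpq : p ^ 2 + q ^ 2 = 1) (hne : y ≠ 0 ∨ q ≠ 0) :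
    0 < 2 * x * y * p * (p - 1 - y) + q ^ 2 * (x ^ 2 - y ^ 2) := by
  have hx1 : -1 ≤ x := by nlinarith
  have hp1 : p ≤ 1 := by nlinarith
  have hy2 : y ^ 2 ≤ 1 / 10 := by nlinarith
  have hyabs : |y| ≤ 1 / 3 := abs_le.2 ⟨by nlinarith, by nlinarith⟩
  have h1p : 0 ≤ 1 - p := by linarith
  have h1p' : 1 - p ≤ q ^ 2 := by nlinarith
  have hxp : 0 ≤ -x * p := by nlinarith
  have hxp1 : -x * p ≤ 1 := by nlinarith
  have s1 : -(|y| * (1 - p)) ≤ y * (1 - p) := by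
    have := mul_le_mul_of_nonneg_right (neg_abs_le y) h1p
    linarith
  have s2 : -x * p * (-(|y| * (1 - p))) ≤ -x * p * (y * (1 - p)) :=
    mul_le_mul_of_nonneg_left s1 hxp
  have s3 : -x * p * (|y| * (1 - p)) ≤ 1 * (|y| * q ^ 2) :=
    mul_le_mul hxp1 (mul_le_mul_of_nonneg_left h1p' (abs_nonneg y)) (by positivity) zero_le_one
  have hpos : 0 < y ^ 2 + q ^ 2 := by
    rcases hne with h | h <;> positivity
  have hid : 2 * x * y * p * (p - 1 - y) =
      2 * (-x * p * (y * (1 - p))) + 2 * (-x * p) * y ^ 2 := by ring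
  rw [hid]
  nlinarith [sq_abs y, abs_nonneg y]

/-- **Estimate at `(1, 1)`**: for `Re σ ≥ 19/20`, `Re τ ≥ 1/2`, `(σ, τ) ≠ (1, 1)`,
`Re ((Im σ²/Re σ² + i Im τ/Re τ) · ((τ - 1) - Im σ)) < 0` — the plumbing coordinate direction of
`S₂` near its first plumbing point is within `90°` of `-conj` of the reference. [folklore] -/
theorem re_axisCoord_mul_refFraming_neg {σ τ : Circle} (hσ : 19 / 20 ≤ (σ : ℂ).re)
    (hτ : 1 / 2 ≤ (τ : ℂ).re) (hne : ¬ (σ = 1 ∧ τ = 1)) :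
    ((((((σ : ℂ) ^ 2).im / ((σ : ℂ) ^ 2).re : ℝ) : ℂ) +
        ((((τ : ℂ).im / (τ : ℂ).re : ℝ)) : ℂ) * I) *
      (((τ : ℂ) - 1) - (((σ : ℂ).im : ℝ) : ℂ))).re < 0 := by
  have hσ1 := re_sq_add_im_sq σ
  have hτ1 := re_sq_add_im_sq τ
  have hX : 0 < (σ : ℂ).re ^ 2 - (σ : ℂ).im ^ 2 := by nlinarith
  have hp : 0 < (τ : ℂ).re := by linarith
  have hne' : (σ : ℂ).im ≠ 0 ∨ (τ : ℂ).im ≠ 0 := by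
    by_contra h
    push Not at h
    exact hne ⟨eq_one_of_im_eq_zero h.1 (by linarith), eq_one_of_im_eq_zero h.2 hp⟩
  have hg : ((τ : ℂ) - 1) - (((σ : ℂ).im : ℝ) : ℂ) =
      (((τ : ℂ).re - 1 - (σ : ℂ).im : ℝ) : ℂ) + (((τ : ℂ).im : ℝ) : ℂ) * I := by
    apply Complex.ext <;> simp
  rw [hg, re_mk_mul_mk, sq_re, sq_im]
  have key := core_axis_neg hσ hσ1 hτ hτ1 hne'
  have hid : 2 * (σ : ℂ).re * (σ : ℂ).im / ((σ : ℂ).re ^ 2 - (σ : ℂ).im ^ 2) *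
        ((τ : ℂ).re - 1 - (σ : ℂ).im) - (τ : ℂ).im / (τ : ℂ).re * (τ : ℂ).im =
      (2 * (σ : ℂ).re * (σ : ℂ).im * (τ : ℂ).re * ((τ : ℂ).re - 1 - (σ : ℂ).im) -
        (τ : ℂ).im ^ 2 * ((σ : ℂ).re ^ 2 - (σ : ℂ).im ^ 2)) /
        (((σ : ℂ).re ^ 2 - (σ : ℂ).im ^ 2) * (τ : ℂ).re) := by
    field_simp
  rw [hid]
  exact div_neg_of_neg_of_pos key (by positivity)

/-- **Estimate at `(-1, 1)`**: for `Re σ ≤ -19/20`, `Re τ ≥ 1/2`, `(σ, τ) ≠ (-1, 1)`,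
`Re ((Im σ²/Re σ² + i Im τ/Re τ) · conj ((τ - 1) - Im σ)) > 0`. [folklore] -/
theorem re_axisCoord_mul_conj_refFraming_pos {σ τ : Circle} (hσ : (σ : ℂ).re ≤ -(19 / 20))
    (hτ : 1 / 2 ≤ (τ : ℂ).re) (hne : ¬ ((σ : ℂ) = -1 ∧ τ = 1)) :
    0 < ((((((σ : ℂ) ^ 2).im / ((σ : ℂ) ^ 2).re : ℝ) : ℂ) +
        ((((τ : ℂ).im / (τ : ℂ).re : ℝ)) : ℂ) * I) *
      conj (((τ : ℂ) - 1) - (((σ : ℂ).im : ℝ) : ℂ))).re := by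
  have hσ1 := re_sq_add_im_sq σ
  have hτ1 := re_sq_add_im_sq τ
  have hX : 0 < (σ : ℂ).re ^ 2 - (σ : ℂ).im ^ 2 := by nlinarith
  have hp : 0 < (τ : ℂ).re := by linarith
  have hne' : (σ : ℂ).im ≠ 0 ∨ (τ : ℂ).im ≠ 0 := by
    by_contra h
    push Not at h
    exact hne ⟨coe_eq_neg_one_of_im_eq_zero h.1 (by linarith), eq_one_of_im_eq_zero h.2 hp⟩
  have hg : conj (((τ : ℂ) - 1) - (((σ : ℂ).im : ℝ) : ℂ)) =
      (((τ : ℂ).re - 1 - (σ : ℂ).im : ℝ) : ℂ) + ((-(τ : ℂ).im : ℝ) : ℂ) * I := by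
    apply Complex.ext <;> simp
  rw [hg, re_mk_mul_mk, sq_re, sq_im]
  have key := core_axis_pos hσ hσ1 hτ hτ1 hne'
  have hid : 2 * (σ : ℂ).re * (σ : ℂ).im / ((σ : ℂ).re ^ 2 - (σ : ℂ).im ^ 2) *
        ((τ : ℂ).re - 1 - (σ : ℂ).im) - (τ : ℂ).im / (τ : ℂ).re * -(τ : ℂ).im =
      (2 * (σ : ℂ).re * (σ : ℂ).im * (τ : ℂ).re * ((τ : ℂ).re - 1 - (σ : ℂ).im) +
        (τ : ℂ).im ^ 2 * ((σ : ℂ).re ^ 2 - (σ : ℂ).im ^ 2)) /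
        (((σ : ℂ).re ^ 2 - (σ : ℂ).im ^ 2) * (τ : ℂ).re) := by
    field_simp
    ring
  rw [hid]
  positivity

/-! ### §2 The first torus `T`: reference `g₁ = (z₂ - 1) + (Re (z₁ ϑ) - Re ϑ)`, `ϑ = e^{i r₀}` -/

/-- Real and imaginary parts of `ϑ = e^{i r₀}`. [folklore] -/
theorem coe_circleExp_re_im (r₀ : ℝ) :
    ((Circle.exp r₀ : Circle) : ℂ).re = Real.cos r₀ ∧ ((Circle.exp r₀ : Circle) : ℂ).im = Real.sin r₀ := by
  rw [Circle.coe_exp]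
  exact ⟨Complex.exp_ofReal_mul_I_re r₀, Complex.exp_ofReal_mul_I_im r₀⟩

/-- **The first reference framing vanishes exactly at `x₂ = (1, 1)` and `x₃ = (ϑ⁻², 1)`**
(`0 < r₀`, `cos r₀ > 0`). [folklore] -/
theorem refFramingFirst_eq_zero_iff {r₀ : ℝ} (hc : 0 < Real.cos r₀) {z₁ z₂ : Circle} :
    ((z₂ : ℂ) - 1) + ((((z₁ : ℂ) * (Circle.exp r₀ : ℂ)).re - ((Circle.exp r₀ : Circle) : ℂ).re : ℝ) : ℂ)
        = 0 ↔ z₂ = 1 ∧ (z₁ = 1 ∨ z₁ = ((Circle.exp r₀)⁻¹) ^ 2) := by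
  set ϑ : Circle := Circle.exp r₀ with hϑ
  constructor
  · intro h
    have him : (z₂ : ℂ).im = 0 := by simpa using congrArg Complex.im h
    have hre : (z₂ : ℂ).re - 1 + (((z₁ : ℂ) * (ϑ : ℂ)).re - (ϑ : ℂ).re) = 0 := by
      simpa using congrArg Complex.re h
    have h2 := re_sq_add_im_sq z₂
    rw [him] at h2
    -- `Re (z₁ ϑ) - Re ϑ ≤ 1 - cos r₀ < 2`, so `Re z₂ = 1`
    have hw := re_sq_add_im_sq (z₁ * ϑ)
    have hϑre : (ϑ : ℂ).re = Real.cos r₀ := (coe_circleExp_re_im r₀).1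
    have hwre : ((z₁ : ℂ) * (ϑ : ℂ)).re ≤ 1 := by
      have : ((z₁ * ϑ : Circle) : ℂ) = (z₁ : ℂ) * (ϑ : ℂ) := Circle.coe_mul z₁ ϑ
      rw [← this]
      nlinarith [sq_nonneg (((z₁ * ϑ : Circle) : ℂ).im)]
    have h2re : (z₂ : ℂ).re = 1 := by
      rw [hϑre] at hre
      nlinarith
    have hz₂ : z₂ = 1 := eq_one_of_im_eq_zero him (by rw [h2re]; exact one_pos)
    refine ⟨hz₂, ?_⟩
    have hweq : ((z₁ * ϑ : Circle) : ℂ).re = (ϑ : ℂ).re := by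
      rw [Circle.coe_mul]; linarith
    rcases eq_or_eq_inv_of_re_eq hweq with h1 | h1
    · left
      exact mul_right_cancel (h1.trans (one_mul ϑ).symm)
    · right
      have : z₁ = ϑ⁻¹ * ϑ⁻¹ := by
        calc z₁ = z₁ * ϑ * ϑ⁻¹ := by rw [mul_inv_cancel_right]
          _ = ϑ⁻¹ * ϑ⁻¹ := by rw [h1]
      rw [this, sq]
  · rintro ⟨rfl, h | h⟩
    · subst h
      simp
    · subst h
      have : (((ϑ⁻¹ ^ 2 : Circle) : ℂ) * (ϑ : ℂ)) = ((ϑ⁻¹ : Circle) : ℂ) := by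
        rw [← Circle.coe_mul, sq, mul_assoc, inv_mul_cancel, mul_one]
      rw [this, Circle.coe_inv_eq_conj, Complex.conj_re]
      simp

/-- Polynomial core of the estimate at `x₂`. [folklore] -/
theorem core_first_neg {x y p q S C : ℝ} (hx : 19 / 20 ≤ x) (hxy : x ^ 2 + y ^ 2 = 1)
    (hp : 19 / 20 ≤ p) (hpq : p ^ 2 + q ^ 2 = 1) (hS : 0 < S) (hS1 : S ≤ 1) (hC : 0 ≤ C) (hC1 : C ≤ 1)
    (hy : |y| ≤ S / 4) (hne : y ≠ 0 ∨ q ≠ 0) :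
    2 * x * y * (p - 1 + (C * (x - 1) - y * S)) * (p ^ 2 - q ^ 2) - 2 * p * q ^ 2 * (x ^ 2 - y ^ 2) < 0 := by
  have hx1 : x ≤ 1 := by nlinarith
  have hx0 : 0 ≤ x := by linarith
  have hp1 : p ≤ 1 := by nlinarith
  have hP : 4 / 5 ≤ p ^ 2 - q ^ 2 := by nlinarith
  have hP0 : 0 ≤ p ^ 2 - q ^ 2 := by linarith
  have hP1 : p ^ 2 - q ^ 2 ≤ 1 := by nlinarith
  have hX : 4 / 5 ≤ x ^ 2 - y ^ 2 := by nlinarith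
  have h1p : 0 ≤ 1 - p := by linarith
  have h1p' : 1 - p ≤ q ^ 2 := by nlinarith
  have h1x : 0 ≤ 1 - x := by linarith
  have h1x' : 1 - x ≤ y ^ 2 := by nlinarith
  have hy0 := abs_nonneg y
  -- (ii) the `(p - 1)` cross term
  have hxP : 0 ≤ x * (p ^ 2 - q ^ 2) := mul_nonneg hx0 hP0
  have hxP1 : x * (p ^ 2 - q ^ 2) ≤ 1 := mul_le_one₀ hx1 hP0 hP1
  have s1 : y * (p - 1) ≤ |y| * (1 - p) := by
    have := mul_le_mul_of_nonneg_right (neg_le_abs y) h1p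
    linarith
  have t2 : x * (p ^ 2 - q ^ 2) * (y * (p - 1)) ≤ |y| * q ^ 2 := by
    have a := mul_le_mul_of_nonneg_left s1 hxP
    have b : x * (p ^ 2 - q ^ 2) * (|y| * (1 - p)) ≤ 1 * (|y| * q ^ 2) :=
      mul_le_mul hxP1 (mul_le_mul_of_nonneg_left h1p' hy0) (by positivity) zero_le_one
    linarith
  -- (iii) the `C (x - 1)` cross term
  have hCxP : 0 ≤ C * x * (p ^ 2 - q ^ 2) := mul_nonneg (mul_nonneg hC hx0) hP0
  have hCxP1 : C * x * (p ^ 2 - q ^ 2) ≤ 1 := mul_le_one₀ (mul_le_one₀ hC1 hx0 hx1) hP0 hP1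
  have s2 : y * (x - 1) ≤ |y| * (1 - x) := by
    have := mul_le_mul_of_nonneg_right (neg_le_abs y) h1x
    linarith
  have t3 : C * x * (p ^ 2 - q ^ 2) * (y * (x - 1)) ≤ |y| * y ^ 2 := by
    have a := mul_le_mul_of_nonneg_left s2 hCxP
    have b : C * x * (p ^ 2 - q ^ 2) * (|y| * (1 - x)) ≤ 1 * (|y| * y ^ 2) :=
      mul_le_mul hCxP1 (mul_le_mul_of_nonneg_left h1x' hy0) (by positivity) zero_le_one
    linarith
  have hpos : 0 < y ^ 2 + q ^ 2 := by
    rcases hne with h | h <;> positivity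
  have hid : 2 * x * y * (p - 1 + (C * (x - 1) - y * S)) * (p ^ 2 - q ^ 2) =
      2 * (x * (p ^ 2 - q ^ 2) * (y * (p - 1))) + 2 * (C * x * (p ^ 2 - q ^ 2) * (y * (x - 1))) -
        2 * S * (x * (p ^ 2 - q ^ 2)) * y ^ 2 := by ring
  rw [hid]
  have e3 : |y| * q ^ 2 ≤ S / 4 * q ^ 2 := mul_le_mul_of_nonneg_right hy (sq_nonneg q)
  have e4 : |y| * y ^ 2 ≤ S / 4 * y ^ 2 := mul_le_mul_of_nonneg_right hy (sq_nonneg y)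
  have e5 : S / 4 * q ^ 2 ≤ 1 / 4 * q ^ 2 :=
    mul_le_mul_of_nonneg_right (by linarith) (sq_nonneg q)
  have hxP76 : 19 / 25 ≤ x * (p ^ 2 - q ^ 2) := by nlinarith
  have m1 : 3 / 2 * (S * y ^ 2) ≤ 2 * S * (x * (p ^ 2 - q ^ 2)) * y ^ 2 := by
    have h0 : 0 ≤ S * y ^ 2 := by positivity
    have := mul_le_mul_of_nonneg_left hxP76 h0
    linarith
  have hpX : 3 / 4 ≤ p * (x ^ 2 - y ^ 2) := by nlinarith
  have m4 : 3 / 2 * q ^ 2 ≤ 2 * p * q ^ 2 * (x ^ 2 - y ^ 2) := by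
    have := mul_le_mul_of_nonneg_left hpX (sq_nonneg q)
    linarith
  have hSy : 0 < S * y ^ 2 + q ^ 2 := by
    rcases hne with h | h <;> positivity
  linarith

/-- Polynomial core of the estimate at `x₃`. [folklore] -/
theorem core_first_pos {x y p q S C : ℝ} (hx : 19 / 20 ≤ x) (hxy : x ^ 2 + y ^ 2 = 1)
    (hp : 19 / 20 ≤ p) (hpq : p ^ 2 + q ^ 2 = 1) (hS : 0 < S) (hS1 : S ≤ 1) (hC : 0 ≤ C) (hC1 : C ≤ 1)
    (hy : |y| ≤ S / 4) (hne : y ≠ 0 ∨ q ≠ 0) :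
    0 < 2 * x * y * (p - 1 + (C * (x - 1) + y * S)) * (p ^ 2 - q ^ 2) + 2 * p * q ^ 2 * (x ^ 2 - y ^ 2) := by
  have hy' : |(-y)| ≤ S / 4 := by rwa [abs_neg]
  have hxy' : x ^ 2 + (-y) ^ 2 = 1 := by rwa [neg_sq]
  have hne' : -y ≠ 0 ∨ q ≠ 0 := by
    rcases hne with h | h
    · exact Or.inl (neg_ne_zero.2 h)
    · exact Or.inr h
  have := core_first_neg hx hxy' hp hpq hS hS1 hC hC1 hy' hne'
  nlinarith [this]

/-- **Estimate at `x₂ = (1, 1)`**: `Re ((Im z₁²/Re z₁² + i Im z₂²/Re z₂²) · g₁) < 0` for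
`Re z₁, Re z₂ ≥ 19/20`, `|Im z₁| ≤ sin(r₀)/4`, `(z₁, z₂) ≠ (1, 1)` (`0 < r₀ ≤ π/2`). [folklore] -/
theorem re_quarterCoord_mul_refFraming_neg {r₀ : ℝ} (hs : 0 < Real.sin r₀) (hc : 0 ≤ Real.cos r₀)
    {z₁ z₂ : Circle} (hx : 19 / 20 ≤ (z₁ : ℂ).re) (hy : |(z₁ : ℂ).im| ≤ Real.sin r₀ / 4)
    (hp : 19 / 20 ≤ (z₂ : ℂ).re) (hne : ¬ (z₁ = 1 ∧ z₂ = 1)) :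
    ((((((z₁ : ℂ) ^ 2).im / ((z₁ : ℂ) ^ 2).re : ℝ) : ℂ) +
        (((((z₂ : ℂ) ^ 2).im / ((z₂ : ℂ) ^ 2).re : ℝ)) : ℂ) * I) *
      (((z₂ : ℂ) - 1) + ((((z₁ : ℂ) * (Circle.exp r₀ : ℂ)).re -
        ((Circle.exp r₀ : Circle) : ℂ).re : ℝ) : ℂ))).re < 0 := by
  obtain ⟨hϑre, hϑim⟩ := coe_circleExp_re_im r₀
  have h1 := re_sq_add_im_sq z₁
  have h2 := re_sq_add_im_sq z₂
  have hX : 0 < (z₁ : ℂ).re ^ 2 - (z₁ : ℂ).im ^ 2 := by nlinarith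
  have hP : 0 < (z₂ : ℂ).re ^ 2 - (z₂ : ℂ).im ^ 2 := by nlinarith
  have hne' : (z₁ : ℂ).im ≠ 0 ∨ (z₂ : ℂ).im ≠ 0 := by
    by_contra h
    push Not at h
    exact hne ⟨eq_one_of_im_eq_zero h.1 (by linarith), eq_one_of_im_eq_zero h.2 (by linarith)⟩
  have hmul : ((z₁ : ℂ) * (Circle.exp r₀ : ℂ)).re =
      (z₁ : ℂ).re * Real.cos r₀ - (z₁ : ℂ).im * Real.sin r₀ := by
    rw [Complex.mul_re, hϑre, hϑim]
  have hg : ((z₂ : ℂ) - 1) + ((((z₁ : ℂ) * (Circle.exp r₀ : ℂ)).re -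
        ((Circle.exp r₀ : Circle) : ℂ).re : ℝ) : ℂ) =
      (((z₂ : ℂ).re - 1 + (Real.cos r₀ * ((z₁ : ℂ).re - 1) - (z₁ : ℂ).im * Real.sin r₀) : ℝ) : ℂ) +
        (((z₂ : ℂ).im : ℝ) : ℂ) * I := by
    rw [hmul, hϑre]
    apply Complex.ext
    · simp; ring
    · simp
  rw [hg, re_mk_mul_mk, sq_re, sq_im, sq_re, sq_im]
  have key := core_first_neg hx h1 hp h2 hs (Real.sin_le_one r₀) hc (Real.cos_le_one r₀) hy hne'
  have hid : 2 * (z₁ : ℂ).re * (z₁ : ℂ).im / ((z₁ : ℂ).re ^ 2 - (z₁ : ℂ).im ^ 2) *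
        ((z₂ : ℂ).re - 1 + (Real.cos r₀ * ((z₁ : ℂ).re - 1) - (z₁ : ℂ).im * Real.sin r₀)) -
        2 * (z₂ : ℂ).re * (z₂ : ℂ).im / ((z₂ : ℂ).re ^ 2 - (z₂ : ℂ).im ^ 2) * (z₂ : ℂ).im =
      (2 * (z₁ : ℂ).re * (z₁ : ℂ).im *
          ((z₂ : ℂ).re - 1 + (Real.cos r₀ * ((z₁ : ℂ).re - 1) - (z₁ : ℂ).im * Real.sin r₀)) *
          ((z₂ : ℂ).re ^ 2 - (z₂ : ℂ).im ^ 2) -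
        2 * (z₂ : ℂ).re * (z₂ : ℂ).im ^ 2 * ((z₁ : ℂ).re ^ 2 - (z₁ : ℂ).im ^ 2)) /
        (((z₁ : ℂ).re ^ 2 - (z₁ : ℂ).im ^ 2) * ((z₂ : ℂ).re ^ 2 - (z₂ : ℂ).im ^ 2)) := by
    field_simp
  rw [hid]
  exact div_neg_of_neg_of_pos key (by positivity)

/-- **Estimate at `x₃ = (ϑ⁻², 1)`**, in the variable `ζ = z₁ ϑ²` of the quarter chart at `x₃`
(so `z₁ ϑ = ζ ϑ⁻¹`): `Re ((Im ζ²/Re ζ² + i Im z₂²/Re z₂²) · conj g₁) > 0` for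
`Re ζ, Re z₂ ≥ 19/20`, `|Im ζ| ≤ sin(r₀)/4`, `(ζ, z₂) ≠ (1, 1)`. [folklore] -/
theorem re_quarterCoord_mul_conj_refFraming_pos {r₀ : ℝ} (hs : 0 < Real.sin r₀)
    (hc : 0 ≤ Real.cos r₀) {ζ z₂ : Circle} (hx : 19 / 20 ≤ (ζ : ℂ).re)
    (hy : |(ζ : ℂ).im| ≤ Real.sin r₀ / 4) (hp : 19 / 20 ≤ (z₂ : ℂ).re) (hne : ¬ (ζ = 1 ∧ z₂ = 1)) :
    0 < ((((((ζ : ℂ) ^ 2).im / ((ζ : ℂ) ^ 2).re : ℝ) : ℂ) +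
        (((((z₂ : ℂ) ^ 2).im / ((z₂ : ℂ) ^ 2).re : ℝ)) : ℂ) * I) *
      conj (((z₂ : ℂ) - 1) + ((((ζ : ℂ) * ((Circle.exp r₀)⁻¹ : Circle)).re -
        ((Circle.exp r₀ : Circle) : ℂ).re : ℝ) : ℂ))).re := by
  obtain ⟨hϑre, hϑim⟩ := coe_circleExp_re_im r₀
  have h1 := re_sq_add_im_sq ζ
  have h2 := re_sq_add_im_sq z₂
  have hX : 0 < (ζ : ℂ).re ^ 2 - (ζ : ℂ).im ^ 2 := by nlinarith
  have hP : 0 < (z₂ : ℂ).re ^ 2 - (z₂ : ℂ).im ^ 2 := by nlinarith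
  have hne' : (ζ : ℂ).im ≠ 0 ∨ (z₂ : ℂ).im ≠ 0 := by
    by_contra h
    push Not at h
    exact hne ⟨eq_one_of_im_eq_zero h.1 (by linarith), eq_one_of_im_eq_zero h.2 (by linarith)⟩
  have hinv : (((Circle.exp r₀)⁻¹ : Circle) : ℂ) = (Real.cos r₀ : ℂ) - (Real.sin r₀ : ℂ) * I := by
    rw [Circle.coe_inv_eq_conj]
    apply Complex.ext
    · rw [Complex.conj_re, hϑre]
      simp only [Complex.sub_re, Complex.ofReal_re, Complex.mul_re, Complex.I_re, Complex.I_im,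
        Complex.ofReal_im]
      ring
    · rw [Complex.conj_im, hϑim]
      simp only [Complex.sub_im, Complex.ofReal_im, Complex.mul_im, Complex.I_re, Complex.I_im,
        Complex.ofReal_re]
      ring
  have hmul : ((ζ : ℂ) * ((Circle.exp r₀)⁻¹ : Circle)).re =
      (ζ : ℂ).re * Real.cos r₀ + (ζ : ℂ).im * Real.sin r₀ := by
    rw [hinv]
    simp only [Complex.mul_re, Complex.sub_re, Complex.sub_im, Complex.mul_im, Complex.ofReal_re,
      Complex.ofReal_im, Complex.I_re, Complex.I_im]
    ring
  have hg : conj (((z₂ : ℂ) - 1) + ((((ζ : ℂ) * ((Circle.exp r₀)⁻¹ : Circle)).re -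
        ((Circle.exp r₀ : Circle) : ℂ).re : ℝ) : ℂ)) =
      (((z₂ : ℂ).re - 1 + (Real.cos r₀ * ((ζ : ℂ).re - 1) + (ζ : ℂ).im * Real.sin r₀) : ℝ) : ℂ) +
        ((-(z₂ : ℂ).im : ℝ) : ℂ) * I := by
    rw [hmul, hϑre]
    apply Complex.ext
    · simp; ring
    · simp
  rw [hg, re_mk_mul_mk, sq_re, sq_im, sq_re, sq_im]
  have key := core_first_pos hx h1 hp h2 hs (Real.sin_le_one r₀) hc (Real.cos_le_one r₀) hy hne'
  have hid : 2 * (ζ : ℂ).re * (ζ : ℂ).im / ((ζ : ℂ).re ^ 2 - (ζ : ℂ).im ^ 2) *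
        ((z₂ : ℂ).re - 1 + (Real.cos r₀ * ((ζ : ℂ).re - 1) + (ζ : ℂ).im * Real.sin r₀)) -
        2 * (z₂ : ℂ).re * (z₂ : ℂ).im / ((z₂ : ℂ).re ^ 2 - (z₂ : ℂ).im ^ 2) * -(z₂ : ℂ).im =
      (2 * (ζ : ℂ).re * (ζ : ℂ).im *
          ((z₂ : ℂ).re - 1 + (Real.cos r₀ * ((ζ : ℂ).re - 1) + (ζ : ℂ).im * Real.sin r₀)) *
          ((z₂ : ℂ).re ^ 2 - (z₂ : ℂ).im ^ 2) +
        2 * (z₂ : ℂ).re * (z₂ : ℂ).im ^ 2 * ((ζ : ℂ).re ^ 2 - (ζ : ℂ).im ^ 2)) /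
        (((ζ : ℂ).re ^ 2 - (ζ : ℂ).im ^ 2) * ((z₂ : ℂ).re ^ 2 - (z₂ : ℂ).im ^ 2)) := by
    field_simp
    ring
  rw [hid]
  positivity

end BraidFraming

end Literature.Topology.FourManifolds
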